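import Summits.ABC.ABC.Theorems.ManyPrimeValuationProduct.Negative.ConstantBlowup
import Summits.ABC.ABC.Theorems.ManyPrimeValuationProduct.Negative.MidCensusThresholdFree

/-!
# `ManyPrimeValuationProduct` (stmt-ABC-1561): the crux constant `C_ε` is DOUBLY exponential in `1/ε`

Negative support (drefute seat `refuter-drefute-stmt-ABC-1561-g3-0`, gen 3, 2026-08-16), crux `stmt-ABC-1561`
(route `RibetTakahashiSplit`), line `unramified-window-census`; symbolic version of the instances in
`Negative/ConstantBlowup.lean`.  Witness family: the Frey curves `G_k = F((4^k)#, 2) : y² = x (x + 1)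
(x + 32 ((4^k)#)²)` of `Negative/WindowCensusFamily.lean`; by Chebyshev (`Mathlib.NumberTheory.Chebyshev`,
through `Negative/MidCensusThresholdFree.lean`): `log T(G_k) ≥ (π(4^k) − 1) log 4 ≥ ((4^k − 4k − 1)/(2k))
log 4` (`log_valuationProduct_two_ge`, `primeCounting_four_pow_ge`), `θ(n) ≤ log N(F(n#,2)) < 6 log 2 +
3 θ(n)` (`theta_le_log_conductorNorm_two`, `log_conductorNorm_two_lt`), `θ(4^k) ≤ log 4 · 4^k`.

* `manyPrime_constant_ge_exp_exp`: for `0 < ε ≤ 1/320`, every `C` admissible in the crux inequality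
  `T(E) ≤ C N^ε` on the class satisfies `C ≥ exp (exp (1/(12 ε)))` (`k = ⌊1/(12ε)⌋`:
  `log C ≥ log 4 · 4^k/(4k) − 3 ≥ 3^{k+1} > exp (1/(12ε))`).

Paper constant: `log log C_ε ≥ (2 log 2/3 − o(1))/ε` (`n = 4^{(1−o(1))/(3ε)}`); `1/12` here after the
Chebyshev constants `log 2`/`log 4` and rounding.  This is the divisor-bound phenomenon (`T` behaves like
`d(Δ_min)`, cf. Disproof §1; for `d(n) ≤ C_ε n^ε` one has `log log C_ε ∼ log 2/ε`): no proof of the crux can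
produce `C_ε = exp(exp(o(1/ε)))`, let alone constants polynomial or simply exponential in `1/ε`; it subsumes
Disproof §3/§4 (`ε`-free, uniform-constant and polylog versions false).  It refutes nothing ABC implies.
-/

noncomputable section

-- `Summit.<Summit>.<Problem>`: for the single-conjunct summit `ABC` the duplicate `ABC.ABC` is mandated.
set_option linter.dupNamespace false

namespace Summit.ABC.ABC.Theorems.ManyPrimeValuationProduct.Negative

open Literature.NumberTheory.EllipticCurves UniqueFactorizationMonoid Real Finset Chebyshev

/-! ## §1 The curves `G_k = F((4^k)#, 2)` against Chebyshev -/

/-- `n# ∣ N (F(n#, 2))` (the conductor is the radical of `32 (n#)² (32 (n#)² − 1)` and `n#` is squarefree).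
[folklore] -/
theorem primorial_dvd_conductorNorm_two (n : ℕ) :
    primorial n ∣ (freyCurve (-1) (32 * ((primorial n : ℕ) : ℤ) ^ 2)).conductorNorm ℤ := by
  have hM : 1 ≤ primorial n := primorial_pos n
  rw [family_conductorNorm (primorial n) 2 hM]
  refine (UniqueFactorizationMonoid.dvd_radical_iff (squarefree_primorial n).isRadical
    (family_param_ne_zero (primorial n) 2 hM)).mpr ?_
  exact Dvd.dvd.mul_right (Dvd.dvd.mul_left (dvd_pow_self _ (by norm_num)) 32) _

/-- `θ(n) ≤ log N (F(n#, 2))`. [folklore] -/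
theorem theta_le_log_conductorNorm_two (n : ℕ) :
    θ n ≤ Real.log ((freyCurve (-1) (32 * ((primorial n : ℕ) : ℤ) ^ 2)).conductorNorm ℤ) := by
  have hM : 1 ≤ primorial n := primorial_pos n
  haveI := family_isElliptic (primorial n) 2 hM
  have hle := Nat.le_of_dvd (WeierstrassCurve.conductorNorm_pos_holds _) (primorial_dvd_conductorNorm_two n)
  rw [theta_eq_log_primorial, Nat.floor_natCast]
  exact Real.log_le_log (by exact_mod_cast primorial_pos n) (by exact_mod_cast hle)

/-- `log N (F(n#, 2)) < 6 log 2 + 3 θ(n)` (`N < 64 (n#)³`). [folklore] -/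
theorem log_conductorNorm_two_lt (n : ℕ) :
    Real.log ((freyCurve (-1) (32 * ((primorial n : ℕ) : ℤ) ^ 2)).conductorNorm ℤ)
      < 6 * Real.log 2 + 3 * θ n := by
  have hM : 1 ≤ primorial n := primorial_pos n
  haveI := family_isElliptic (primorial n) 2 hM
  have hNpos : 0 < (freyCurve (-1) (32 * ((primorial n : ℕ) : ℤ) ^ 2)).conductorNorm ℤ :=
    WeierstrassCurve.conductorNorm_pos_holds _
  have hlt := family_conductorNorm_lt (primorial n) 2 hM
  have hN : ((freyCurve (-1) (32 * ((primorial n : ℕ) : ℤ) ^ 2)).conductorNorm ℤ : ℝ)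
      < 64 * ((primorial n : ℕ) : ℝ) ^ 3 := by exact_mod_cast hlt
  have hP : (0 : ℝ) < ((primorial n : ℕ) : ℝ) := by exact_mod_cast primorial_pos n
  calc Real.log ((freyCurve (-1) (32 * ((primorial n : ℕ) : ℤ) ^ 2)).conductorNorm ℤ)
      < Real.log (64 * ((primorial n : ℕ) : ℝ) ^ 3) := Real.log_lt_log (by exact_mod_cast hNpos) hN
    _ = 6 * Real.log 2 + 3 * Real.log ((primorial n : ℕ) : ℝ) := by
        rw [Real.log_mul (by norm_num) (by positivity), Real.log_pow,
          show (64 : ℝ) = 2 ^ 6 by norm_num, Real.log_pow]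
        push_cast; ring
    _ = 6 * Real.log 2 + 3 * θ n := by rw [theta_eq_log_primorial, Nat.floor_natCast]

/-- **Valuation product of `F(n#, 2)`**: `(π(n) − 1) · log 4 ≤ log T` (every odd prime `≤ n` has `v_p ≥ 4`).
[folklore] -/
theorem log_valuationProduct_two_ge (n : ℕ) (hn : 2 ≤ n) :
    ((Nat.primeCounting n : ℝ) - 1) * Real.log 4 ≤
      Real.log ((∏ p ∈ ((freyCurve (-1) (32 * ((primorial n : ℕ) : ℤ) ^ 2)).conductorNorm ℤ).primeFactors
        with ¬ p ^ 2 ∣ (freyCurve (-1) (32 * ((primorial n : ℕ) : ℤ) ^ 2)).conductorNorm ℤ,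
        ((freyCurve (-1) (32 * ((primorial n : ℕ) : ℤ) ^ 2)).minimalDiscriminantNorm ℤ).factorization p
          : ℕ) : ℝ) := by
  have hM : 1 ≤ primorial n := primorial_pos n
  have h := family_pow_card_le_valuationProduct (primorial n) 2 hM (by norm_num)
    ((Nat.primesLE n).filter (· ≠ 2)) (oddPrimesLE_spec n)
  rw [card_oddPrimesLE n hn] at h
  have h1 : 1 ≤ Nat.primeCounting n := by
    rw [← Nat.primesLE_card_eq_primeCounting]
    exact Finset.card_pos.mpr ⟨2, Nat.mem_primesLE.mpr ⟨hn, Nat.prime_two⟩⟩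
  have hR : (4 : ℝ) ^ (Nat.primeCounting n - 1) ≤
      ((∏ p ∈ ((freyCurve (-1) (32 * ((primorial n : ℕ) : ℤ) ^ 2)).conductorNorm ℤ).primeFactors
        with ¬ p ^ 2 ∣ (freyCurve (-1) (32 * ((primorial n : ℕ) : ℤ) ^ 2)).conductorNorm ℤ,
        ((freyCurve (-1) (32 * ((primorial n : ℕ) : ℤ) ^ 2)).minimalDiscriminantNorm ℤ).factorization p
          : ℕ) : ℝ) := by exact_mod_cast h
  have hpos : (0 : ℝ) < (4 : ℝ) ^ (Nat.primeCounting n - 1) := by positivity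
  have hlog := Real.log_le_log hpos hR
  rw [Real.log_pow, Nat.cast_sub h1, Nat.cast_one] at hlog
  exact hlog

/-! ## §2 Elementary growth facts -/

/-- `40 k 3^k ≤ 4^k` for `k ≥ 25`. [folklore] -/
theorem forty_mul_three_pow_le (k : ℕ) (hk : 25 ≤ k) : 40 * k * 3 ^ k ≤ 4 ^ k := by
  induction k, hk using Nat.le_induction with
  | base => norm_num
  | succ m hm ih =>
    have h3 : 3 ^ (m + 1) = 3 * 3 ^ m := by rw [pow_succ]; ring
    have h4 : 4 ^ (m + 1) = 4 * 4 ^ m := by rw [pow_succ]; ring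
    rw [h3, h4]
    have h120 : 120 * 3 ^ m ≤ 40 * m * 3 ^ m := Nat.mul_le_mul_right (3 ^ m) (by omega)
    nlinarith [ih, h120]

/-- `exp x < 3^(k+1)` when `x < k + 1`. [folklore] -/
theorem exp_lt_three_pow {x : ℝ} {k : ℕ} (hx : x < k + 1) : Real.exp x < (3 : ℝ) ^ (k + 1) := by
  have h1 : Real.exp x < Real.exp ((k + 1 : ℕ) : ℝ) := Real.exp_lt_exp.mpr (by push_cast; exact hx)
  have h2 : Real.exp ((k + 1 : ℕ) : ℝ) = Real.exp 1 ^ (k + 1) := by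
    rw [← Real.exp_one_pow]
  have h3 : Real.exp 1 ^ (k + 1) < (3 : ℝ) ^ (k + 1) :=
    pow_lt_pow_left₀ (lt_trans Real.exp_one_lt_d9 (by norm_num)) (Real.exp_pos 1).le (by omega)
  linarith [h2 ▸ h1]

/-! ## §3 The crux constant is doubly exponential in `1/ε` -/

/-- Real-arithmetic core.  With `a = 4^k`, `t = 3^k`, `kk = k ≥ 26`, `12 kk ε ≤ 1`, `40 kk t ≤ a`,
`L2 = log 2`, `L4 = log 4`: the inequalities `(a − 4kk − 1) L4 ≤ 2kk · logT`,
`logT ≤ logC + ε logN`, `logN ≤ 6 L2 + 3 L4 a` force `3t ≤ logC`. [folklore] -/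
theorem crux_asymptotic_core {a t kk ε L2 L4 logT logC logN : ℝ} (hkk : 26 ≤ kk) (hε : 0 ≤ ε)
    (hεk : 12 * kk * ε ≤ 1) (hat : 40 * kk * t ≤ a) (ht : 1 ≤ t)
    (hL2 : 0.6931471803 < L2) (hL2' : L2 < 0.6931471808) (hL4 : L4 = 2 * L2)
    (hT : (a - 4 * kk - 1) * L4 ≤ 2 * kk * logT) (hC : logT ≤ logC + ε * logN)
    (hN : logN ≤ 6 * L2 + 3 * L4 * a) : 3 * t ≤ logC := by
  have hkk0 : 0 < kk := by linarith
  have ha0 : 0 ≤ a := by nlinarith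
  -- multiply `hC` by `2kk`, `hN` by `2kk ε`
  have h1 : 2 * kk * logT ≤ 2 * kk * logC + 2 * kk * ε * logN := by nlinarith
  have h2 : 2 * kk * ε * logN ≤ 2 * kk * ε * (6 * L2 + 3 * L4 * a) :=
    mul_le_mul_of_nonneg_left hN (by positivity)
  -- the `ε`-terms against `12 kk ε ≤ 1`
  have h3 : 2 * kk * ε * (3 * L4 * a) ≤ L4 * a / 2 := by
    have : 0 ≤ L4 * a := by nlinarith
    nlinarith
  have h4 : 2 * kk * ε * (6 * L2) ≤ L2 := by nlinarith
  -- `a L4 / 2 ≥ 20 kk t L4 ≥ 27 kk t`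
  have h5 : 20 * kk * t * L4 ≤ L4 * a / 2 := by
    have : 0 ≤ L4 := by linarith
    nlinarith
  have h6 : 27 * (kk * t) ≤ 20 * kk * t * L4 := by
    have : 0 ≤ kk * t := by positivity
    nlinarith
  have h7 : kk ≤ kk * t := by nlinarith
  -- assemble: `2kk logC ≥ a L4 − 4kk L4 − L4 − L2 − a L4/2 ≥ 27 kk t − 5.6 kk − 2.1 ≥ 6 kk t`
  have h8 : 2 * kk * (3 * t) ≤ 2 * kk * logC := by nlinarith
  exact le_of_mul_le_mul_left h8 (by linarith)

/-- **The crux constant is at least doubly exponential in `1/ε`.**  For `0 < ε ≤ 1/320`, every `C` for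
which the crux inequality `T(E) ≤ C · N^ε` holds on the class satisfies `C ≥ exp (exp (1/(12 ε)))`.
Witness: `F((4^k)#, 2)` with `k = ⌊1/(12ε)⌋` — `log T ≥ (π(4^k) − 1) log 4 ≥ ((4^k − 4k − 1)/(2k)) log 4`
(Chebyshev, `primeCounting_four_pow_ge`), `log N < 6 log 2 + 3 θ(4^k) ≤ 6 log 2 + 3 log 4 · 4^k`
(`theta_le_log4_mul_x`), whence `log C ≥ log 4 · 4^k/(4k) − 3 ≥ 3^{k+1} > exp (1/(12ε))`.  (Paper constant:
`log log C_ε ≥ (2 log 2/3 − o(1))/ε`; here `1/12` after Chebyshev-constant and rounding losses.) The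
hypothesis is the body of `Summit.ABC.ABC.Theses.RibetTakahashiSplit.ManyPrimeValuationProduct` at `ε`.
[folklore] -/
theorem manyPrime_constant_ge_exp_exp (ε : ℝ) (hε : 0 < ε) (hε' : ε ≤ 1 / 320) (C : ℝ)
    (hC : ∀ (W : WeierstrassCurve ℚ) [W.IsElliptic],
      (∀ p : ℕ, p.Prime → p ≠ 2 → ¬ p ^ 2 ∣ W.conductorNorm ℤ) →
      4 ≤ ((W.conductorNorm ℤ).primeFactors.filter
        (fun p => p ≠ 2 ∧ ¬ p ^ 2 ∣ W.conductorNorm ℤ)).card →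
      ((∏ p ∈ (W.conductorNorm ℤ).primeFactors with ¬ p ^ 2 ∣ W.conductorNorm ℤ,
        (W.minimalDiscriminantNorm ℤ).factorization p : ℕ) : ℝ) ≤ C * (W.conductorNorm ℤ : ℝ) ^ ε) :
    Real.exp (Real.exp (1 / (12 * ε))) ≤ C := by
  -- (1) the parameter `k = ⌊1/(12ε)⌋`
  obtain ⟨k, hk⟩ : ∃ k : ℕ, k = ⌊1 / (12 * ε)⌋₊ := ⟨_, rfl⟩
  have hx0 : (0 : ℝ) ≤ 1 / (12 * ε) := by positivity
  have hk_le : (k : ℝ) ≤ 1 / (12 * ε) := by rw [hk]; exact Nat.floor_le hx0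
  have hk_gt : 1 / (12 * ε) < k + 1 := by rw [hk]; exact Nat.lt_floor_add_one _
  have hk26 : 26 ≤ k := by
    rw [hk]
    refine Nat.le_floor ?_
    rw [le_div_iff₀ (by positivity)]
    push_cast
    nlinarith
  have hεk : 12 * (k : ℝ) * ε ≤ 1 := by
    have := (le_div_iff₀ (by positivity : (0 : ℝ) < 12 * ε)).mp hk_le
    linarith
  -- (2) the curve `F((4^k)#, 2)`
  obtain ⟨n, hn⟩ : ∃ n : ℕ, n = 4 ^ k := ⟨_, rfl⟩
  have hn11 : 11 ≤ n := by
    rw [hn]; exact le_trans (by norm_num) (Nat.pow_le_pow_right (by norm_num) (show 2 ≤ k by omega))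
  have hM : 1 ≤ primorial n := primorial_pos n
  haveI := family_isElliptic (primorial n) 2 hM
  have h := hC (freyCurve (-1) (32 * ((primorial n : ℕ) : ℤ) ^ 2)) (family_semistable _ 2 hM)
    (family_four_le_card _ 2 hM (by norm_num) (dvd_primorial_1155 n hn11))
  -- (3) logarithms: `log T ≤ log C + ε log N`
  have hTlo := log_valuationProduct_two_ge n (by omega)
  have hNhi := log_conductorNorm_two_lt n
  have hθhi := theta_four_pow_le k
  have hπ := primeCounting_four_pow_ge k (by omega)
  rw [← hn] at hθhi hπ
  have hNpos : (0 : ℝ) < ((freyCurve (-1) (32 * ((primorial n : ℕ) : ℤ) ^ 2)).conductorNorm ℤ : ℝ) :=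
    Nat.cast_pos.mpr (WeierstrassCurve.conductorNorm_pos_holds _)
  have h1π : 1 ≤ Nat.primeCounting n := by
    rw [← Nat.primesLE_card_eq_primeCounting]
    exact Finset.card_pos.mpr ⟨2, Nat.mem_primesLE.mpr ⟨by omega, Nat.prime_two⟩⟩
  have hTpos : (0 : ℝ) < ((∏ p ∈ ((freyCurve (-1) (32 * ((primorial n : ℕ) : ℤ) ^ 2)).conductorNorm
      ℤ).primeFactors with ¬ p ^ 2 ∣ (freyCurve (-1) (32 * ((primorial n : ℕ) : ℤ) ^ 2)).conductorNorm ℤ,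
        ((freyCurve (-1) (32 * ((primorial n : ℕ) : ℤ) ^ 2)).minimalDiscriminantNorm ℤ).factorization p
          : ℕ) : ℝ) := by
    have h4 : (0 : ℝ) < (4 : ℝ) ^ (Nat.primeCounting n - 1) := by positivity
    have hge := family_pow_card_le_valuationProduct (primorial n) 2 hM (by norm_num)
      ((Nat.primesLE n).filter (· ≠ 2)) (oddPrimesLE_spec n)
    rw [card_oddPrimesLE n (by omega)] at hge
    have hge' : (4 : ℝ) ^ (Nat.primeCounting n - 1) ≤ ((∏ p ∈ ((freyCurve (-1)
        (32 * ((primorial n : ℕ) : ℤ) ^ 2)).conductorNorm ℤ).primeFactors with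
          ¬ p ^ 2 ∣ (freyCurve (-1) (32 * ((primorial n : ℕ) : ℤ) ^ 2)).conductorNorm ℤ,
        ((freyCurve (-1) (32 * ((primorial n : ℕ) : ℤ) ^ 2)).minimalDiscriminantNorm ℤ).factorization p
          : ℕ) : ℝ) := by exact_mod_cast hge
    exact lt_of_lt_of_le h4 hge'
  have hrpow : 0 < ((freyCurve (-1) (32 * ((primorial n : ℕ) : ℤ) ^ 2)).conductorNorm ℤ : ℝ) ^ ε :=
    Real.rpow_pos_of_pos hNpos ε
  have hCpos : 0 < C := by
    by_contra hle
    push Not at hle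
    have : C * ((freyCurve (-1) (32 * ((primorial n : ℕ) : ℤ) ^ 2)).conductorNorm ℤ : ℝ) ^ ε ≤ 0 :=
      mul_nonpos_of_nonpos_of_nonneg hle hrpow.le
    linarith
  have hlogC : Real.log ((∏ p ∈ ((freyCurve (-1) (32 * ((primorial n : ℕ) : ℤ) ^ 2)).conductorNorm
      ℤ).primeFactors with ¬ p ^ 2 ∣ (freyCurve (-1) (32 * ((primorial n : ℕ) : ℤ) ^ 2)).conductorNorm ℤ,
        ((freyCurve (-1) (32 * ((primorial n : ℕ) : ℤ) ^ 2)).minimalDiscriminantNorm ℤ).factorization p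
          : ℕ) : ℝ) ≤ Real.log C + ε * Real.log ((freyCurve (-1) (32 * ((primorial n : ℕ) : ℤ) ^ 2)).conductorNorm ℤ : ℝ) := by
    have hlog := Real.log_le_log hTpos h
    rwa [Real.log_mul hCpos.ne' hrpow.ne', Real.log_rpow hNpos] at hlog
  -- (4) the real-arithmetic core
  have hl2 := Real.log_two_gt_d9
  have hl2' := Real.log_two_lt_d9
  have hL4 : Real.log 4 = 2 * Real.log 2 := by
    rw [show (4 : ℝ) = 2 ^ 2 by norm_num, Real.log_pow]; push_cast; ring
  have hkk : (26 : ℝ) ≤ k := by exact_mod_cast hk26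
  have hat : 40 * (k : ℝ) * (3 : ℝ) ^ k ≤ (4 : ℝ) ^ k := by
    exact_mod_cast forty_mul_three_pow_le k (by omega)
  have ht : (1 : ℝ) ≤ (3 : ℝ) ^ k := one_le_pow₀ (by norm_num)
  have hk0 : (0 : ℝ) < k := by linarith
  have hT' : ((4 : ℝ) ^ k - 4 * k - 1) * Real.log 4 ≤ 2 * k * Real.log ((∏ p ∈ ((freyCurve (-1)
      (32 * ((primorial n : ℕ) : ℤ) ^ 2)).conductorNorm ℤ).primeFactors with
        ¬ p ^ 2 ∣ (freyCurve (-1) (32 * ((primorial n : ℕ) : ℤ) ^ 2)).conductorNorm ℤ,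
        ((freyCurve (-1) (32 * ((primorial n : ℕ) : ℤ) ^ 2)).minimalDiscriminantNorm ℤ).factorization p
          : ℕ) : ℝ) := by
    -- `(4^k − 4k − 1)/(2k) ≤ π − 1` and `(π − 1) log 4 ≤ log T`
    have h1 : ((4 : ℝ) ^ k - 4 * k - 1) ≤ 2 * k * ((Nat.primeCounting n : ℝ) - 1) := by
      have := (div_le_iff₀ (by positivity : (0 : ℝ) < 2 * k)).mp hπ
      linarith
    have h4pos : 0 < Real.log 4 := Real.log_pos (by norm_num)
    have h2 := mul_le_mul_of_nonneg_right h1 h4pos.le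
    have h3 := mul_le_mul_of_nonneg_left hTlo (by positivity : (0 : ℝ) ≤ 2 * k)
    nlinarith
  have hN' : Real.log ((freyCurve (-1) (32 * ((primorial n : ℕ) : ℤ) ^ 2)).conductorNorm ℤ : ℝ)
      ≤ 6 * Real.log 2 + 3 * Real.log 4 * (4 : ℝ) ^ k := by nlinarith
  have hcore := crux_asymptotic_core hkk hε.le hεk hat ht hl2 hl2' hL4 hT' hlogC hN'
  -- (5) `exp (1/(12ε)) < 3^{k+1} ≤ log C`
  have hexp : Real.exp (1 / (12 * ε)) < (3 : ℝ) ^ (k + 1) := exp_lt_three_pow hk_gt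
  have h3 : (3 : ℝ) ^ (k + 1) = 3 * (3 : ℝ) ^ k := by rw [pow_succ]; ring
  have hfin : Real.exp (1 / (12 * ε)) ≤ Real.log C := by linarith
  calc Real.exp (Real.exp (1 / (12 * ε))) ≤ Real.exp (Real.log C) := Real.exp_le_exp.mpr hfin
    _ = C := Real.exp_log hCpos

end Summit.ABC.ABC.Theorems.ManyPrimeValuationProduct.Negative
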